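import Summits.BirchSwinnertonDyer.BirchSwinnertonDyer.Theorems.DefiniteThetaDerivedHeightCapTowerSqrtCore
import Summits.BirchSwinnertonDyer.BirchSwinnertonDyer.Theorems.DefiniteThetaDerivedHeightCapIwasawaSerreLevel
import HarnessLib

/-!
# The Iwasawa–Serre identification along a `ℤ_p`-tower: coherent families `(θ_n ∈ ℤ_p[G_n])_n` ↔ power series `L ∈ ℤ_p⟦X⟧`

Route-independent `Theorems` file (cell `b2b-bsdres`, seat `b2b-bsdres-x10b`, gen 46), part 17 of the series «tower square root»
serving crux `DerivedHeightCap` (stmt-BirchSwinnertonDyer-18438, route DefiniteTheta; definition request D2 of the route).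
HONEST FRAMING: no curve asserted, no class closed, BSD not proved by any of this.

Setting of part 3: finite commutative groups `G_n` with onto maps `π_n : G_{n+1} → G_n`, coherent generators `γ_n` (`π_n γ_{n+1} = γ_n`),
`Nat.card G_n = p^{e_n}` with `e_n` unbounded.  Washington's Theorem 7.1 — `ℤ_p⟦Γ⟧ = lim← ℤ_p[Γ/Γ^{p^n}] ≅ ℤ_p⟦T⟧`, `γ ↦ 1 + T` — is
proved here for such towers in the definition-free currency of part 16: "`θ ∈ ℤ_p[G_n]` is the image of `L ∈ ℤ_p⟦X⟧` at level `n`" means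

  `∀ R : ℤ_p[X], ω_{e_n} ∣ L − R (in ℤ_p⟦X⟧) → R(γ_n − 1) = θ`.

* §1 `image_compatible`: the images of one `L` at consecutive levels are compatible under `π_{n*}`; `existsUnique_images`: every `L` has a
  unique family of images, and it is coherent (`images_coherent`).
* §2 ★ `existsUnique_powerSeries_of_coherent`: **every coherent family `(θ_n)_n` is the family of images of exactly ONE `L ∈ ℤ_p⟦X⟧`**
  (existence: coherent polynomial lifts, part 3, and the tree's `IwasawaOmega.exists_forall_omega_dvd_sub` — `ℤ_p⟦X⟧ → lim← ℤ_p⟦X⟧/(ω_m)`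
  is onto; uniqueness: `⋂_m (ω_m) = 0`, `IwasawaOmega.eq_of_forall_omega_dvd_sub`).
* §3 `omega_dvd_sub_coe_of_images_of_aeval_eq` (any polynomial lift of `θ_n` is `≡ L (mod ω_{e_n})`), `images_add`, `images_mul`
  (the bijection is a ring isomorphism `lim←_n ℤ_p[G_n] ≅ ℤ_p⟦X⟧`).

## References
* [Washington1997] L. C. Washington, *Introduction to Cyclotomic Fields*, 2nd ed., §7.1, Thm. 7.1.
* [BertoliniDarmon2005] M. Bertolini, H. Darmon, Ann. of Math. 162 (2005), §1.2 (18)–(21) (`Λ = ℤ_p⟦G_∞⟧`, `G_∞ = lim G_n`).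
-/

noncomputable section

open scoped BigOperators Polynomial

-- D-0017: single-problem summit, the namespace repeats the problem name by design.
set_option linter.dupNamespace false

namespace Summit.BirchSwinnertonDyer.BirchSwinnertonDyer.Theorems.TowerSqrt

open Literature.NumberTheory.EllipticCurves (augIdeal)
open Literature.NumberTheory.EllipticCurves.IwasawaOmega (omega_dvd_omega eq_of_forall_omega_dvd_sub exists_forall_omega_dvd_sub)

universe u

variable (p : ℕ) [hp : Fact p.Prime]

section Tower

variable {G : ℕ → Type u} [∀ n, CommGroup (G n)] (hfin : ∀ n, Finite (G n))
  (π : ∀ n, G (n + 1) →* G n) (γ : ∀ n, G n) (hγ : ∀ n, π n (γ (n + 1)) = γ n)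
  (hgen : ∀ n (g : G n), ∃ k : ℕ, γ n ^ k = g)
  (e : ℕ → ℕ) (hcard : ∀ n, Nat.card (G n) = p ^ e n)

/-! ### §1 The images of one power series form a coherent family -/

include hfin hγ hgen hcard in
/-- **Compatibility of the images of one `L` at consecutive levels**: if `θ'` is the image of `L` in `ℤ_p[G_{n+1}]` and `θ` its image in
`ℤ_p[G_n]`, then `π_{n*} θ' = θ` (`ω_{e_n} ∣ ω_{e_{n+1}}` and `π_* ∘ (X ↦ γ_{n+1} − 1) = (X ↦ γ_n − 1)`). [cite: Washington1997, §7.1 Thm. 7.1] -/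
theorem image_compatible (L : PowerSeries ℤ_[p]) (n : ℕ) {θ' : MonoidAlgebra ℤ_[p] (G (n + 1))} {θ : MonoidAlgebra ℤ_[p] (G n)}
    (h' : ∀ R : ℤ_[p][X], ((1 + PowerSeries.X : PowerSeries ℤ_[p]) ^ p ^ e (n + 1) - 1) ∣ L - (R : PowerSeries ℤ_[p]) →
      (Polynomial.aeval (R := ℤ_[p]) (MonoidAlgebra.of ℤ_[p] _ (γ (n + 1)) - 1)) R = θ')
    (h : ∀ R : ℤ_[p][X], ((1 + PowerSeries.X : PowerSeries ℤ_[p]) ^ p ^ e n - 1) ∣ L - (R : PowerSeries ℤ_[p]) →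
      (Polynomial.aeval (R := ℤ_[p]) (MonoidAlgebra.of ℤ_[p] _ (γ n) - 1)) R = θ) :
    MonoidAlgebra.mapDomainRingHom ℤ_[p] (π n) θ' = θ := by
  obtain ⟨R, -, hR⟩ := exists_poly_omega_dvd_sub p (e (n + 1)) L
  have hmono : e n ≤ e (n + 1) := e_monotone p hfin π γ hγ hgen e hcard n.le_succ
  rw [← h' R hR, mapDomainRingHom_evalGen p (π n) (γ (n + 1)) R, hγ n]
  exact h R ((omega_dvd_omega p hmono).trans hR)

include hcard in
/-- **Every `L ∈ ℤ_p⟦X⟧` has exactly one family of images** `(θ_n ∈ ℤ_p[G_n])_n` (levelwise part 16). [cite: Washington1997, §7.1 Thm. 7.1] -/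
theorem existsUnique_images (L : PowerSeries ℤ_[p]) :
    ∃! θ : ∀ n, MonoidAlgebra ℤ_[p] (G n), ∀ n (R : ℤ_[p][X]),
      ((1 + PowerSeries.X : PowerSeries ℤ_[p]) ^ p ^ e n - 1) ∣ L - (R : PowerSeries ℤ_[p]) →
        (Polynomial.aeval (R := ℤ_[p]) (MonoidAlgebra.of ℤ_[p] _ (γ n) - 1)) R = θ n := by
  have h := fun n => existsUnique_image p (γ n) (e n) (gen_pow_card p γ e hcard n) L
  choose θ hθ huniq using h
  refine ⟨θ, hθ, fun θ' hθ' => funext fun n => huniq n (θ' n) (hθ' n)⟩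

include hfin hγ hgen hcard in
/-- The family of images of one `L` is coherent: `π_{n*} θ_{n+1} = θ_n`. [cite: Washington1997, §7.1 Thm. 7.1] -/
theorem images_coherent (L : PowerSeries ℤ_[p]) {θ : ∀ n, MonoidAlgebra ℤ_[p] (G n)}
    (hθ : ∀ n (R : ℤ_[p][X]), ((1 + PowerSeries.X : PowerSeries ℤ_[p]) ^ p ^ e n - 1) ∣ L - (R : PowerSeries ℤ_[p]) →
      (Polynomial.aeval (R := ℤ_[p]) (MonoidAlgebra.of ℤ_[p] _ (γ n) - 1)) R = θ n) (n : ℕ) :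
    MonoidAlgebra.mapDomainRingHom ℤ_[p] (π n) (θ (n + 1)) = θ n :=
  image_compatible p hfin π γ hγ hgen e hcard L n (hθ (n + 1)) (hθ n)

/-! ### §2 Every coherent family comes from exactly one power series -/

/-- Coherent polynomial lifts are congruent across levels in both directions: `ω_m ∣ F_a − F_b` in `ℤ_p⟦X⟧` whenever `m ≤ e_a` and
`m ≤ e_b`. [folklore] -/
theorem omega_dvd_coe_sub_coe_of_lifts (F : ℕ → ℤ_[p][X])
    (hF : ∀ n m, n ≤ m → ((Polynomial.X + 1 : ℤ_[p][X]) ^ (p ^ (e n)) - 1) ∣ F m - F n)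
    {m a b : ℕ} (ha : m ≤ e a) (hb : m ≤ e b) :
    ((1 + PowerSeries.X : PowerSeries ℤ_[p]) ^ p ^ m - 1) ∣ (F a : PowerSeries ℤ_[p]) - (F b : PowerSeries ℤ_[p]) := by
  rcases le_total a b with hab | hba
  · have h1 := omega_dvd_coe_of_omegaPoly_dvd p (e a) (hF a b hab)
    rw [Polynomial.coe_sub] at h1
    have h2 := (omega_dvd_omega p ha).trans h1
    rw [← dvd_neg, neg_sub] at h2
    exact h2
  · have h1 := omega_dvd_coe_of_omegaPoly_dvd p (e b) (hF b a hba)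
    rw [Polynomial.coe_sub] at h1
    exact (omega_dvd_omega p hb).trans h1

include hfin hγ hgen hcard in
/-- ★ **Existence and uniqueness of the Iwasawa power series of a coherent family**: for every coherent family `θ_n ∈ ℤ_p[G_n]`
(`π_{n*} θ_{n+1} = θ_n`) there is exactly ONE `L ∈ ℤ_p⟦X⟧` whose image at every level `n` is `θ_n` — Washington's
`lim← ℤ_p[G_n] ≅ ℤ_p⟦T⟧`, `γ_n ↦ 1 + T`, for a `ℤ_p`-tower with coherent generators and unbounded orders `p^{e_n}`.
Existence: coherent polynomial lifts `F_n` (part 3) reindexed by the exponent give a compatible family modulo the `ω_m`, which the tree's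
`IwasawaOmega.exists_forall_omega_dvd_sub` lifts to one power series; uniqueness: two such `L` agree modulo every `ω_{e_n}` (part 16), hence
modulo every `ω_m`, hence are equal (`IwasawaOmega.eq_of_forall_omega_dvd_sub`). [cite: Washington1997, §7.1 Thm. 7.1] -/
theorem existsUnique_powerSeries_of_coherent (he : ∀ N : ℕ, ∃ n, N ≤ e n) (θ : ∀ n, MonoidAlgebra ℤ_[p] (G n))
    (hθ : ∀ n, MonoidAlgebra.mapDomainRingHom ℤ_[p] (π n) (θ (n + 1)) = θ n) :
    ∃! L : PowerSeries ℤ_[p], ∀ n (R : ℤ_[p][X]),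
      ((1 + PowerSeries.X : PowerSeries ℤ_[p]) ^ p ^ e n - 1) ∣ L - (R : PowerSeries ℤ_[p]) →
        (Polynomial.aeval (R := ℤ_[p]) (MonoidAlgebra.of ℤ_[p] _ (γ n) - 1)) R = θ n := by
  classical
  haveI : IsAdicComplete (Ideal.span {(p : ℤ_[p])}) ℤ_[p] := by rw [← PadicInt.maximalIdeal_eq_span_p]; infer_instance
  -- coherent polynomial lifts
  obtain ⟨F, hFθ, hF⟩ := exists_coherent_lifts p hfin π γ hγ hgen e hcard θ hθ
  -- reindex by the exponent: ν m is a level with e (ν m) ≥ m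
  let ν : ℕ → ℕ := fun m => Nat.find (he m)
  have hν : ∀ m, m ≤ e (ν m) := fun m => Nat.find_spec (he m)
  obtain ⟨g, hg⟩ := exists_forall_omega_dvd_sub (S := ℤ_[p]) p (fun m => (F (ν m) : PowerSeries ℤ_[p])) fun m =>
    omega_dvd_coe_sub_coe_of_lifts p e F hF ((Nat.le_succ m).trans (hν (m + 1))) (hν m)
  -- g ≡ F n (mod ω_{e n}) for every level n
  have hgF : ∀ n, ((1 + PowerSeries.X : PowerSeries ℤ_[p]) ^ p ^ e n - 1) ∣ g - (F n : PowerSeries ℤ_[p]) := by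
    intro n
    have h1 := hg (e n)
    have h2 := omega_dvd_coe_sub_coe_of_lifts p e F hF (hν (e n)) le_rfl (a := ν (e n)) (b := n)
    have := dvd_add h1 h2
    rwa [sub_add_sub_cancel] at this
  refine ⟨g, fun n R hR => ?_, fun L hL => ?_⟩
  · rw [← hFθ n]
    refine aeval_eq_of_omega_dvd_coe_sub p (γ n) (e n) (gen_pow_card p γ e hcard n) ?_
    have := dvd_sub (hgF n) hR
    rwa [sub_sub_sub_cancel_left] at this
  · -- uniqueness
    have hg' : ∀ n (R : ℤ_[p][X]), ((1 + PowerSeries.X : PowerSeries ℤ_[p]) ^ p ^ e n - 1) ∣ g - (R : PowerSeries ℤ_[p]) →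
        (Polynomial.aeval (R := ℤ_[p]) (MonoidAlgebra.of ℤ_[p] _ (γ n) - 1)) R = θ n := by
      intro n R hR
      rw [← hFθ n]
      refine aeval_eq_of_omega_dvd_coe_sub p (γ n) (e n) (gen_pow_card p γ e hcard n) ?_
      have := dvd_sub (hgF n) hR
      rwa [sub_sub_sub_cancel_left] at this
    refine eq_of_forall_omega_dvd_sub (S := ℤ_[p]) p fun m => ?_
    obtain ⟨n, hn⟩ := he m
    haveI := hfin n
    exact (omega_dvd_omega p hn).trans
      (omega_dvd_sub_of_image_of_image p (γ n) (e n) (gen_pow_card p γ e hcard n) (hgen n) (hcard n) (hL n) (hg' n))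

include hfin hgen hcard in
/-- **Uniqueness half, stated alone**: two power series with the same images at every level of the tower are equal (`e_n` unbounded).
[cite: Washington1997, §7.1 Thm. 7.1] -/
theorem eq_of_images_eq (he : ∀ N : ℕ, ∃ n, N ≤ e n) {L L' : PowerSeries ℤ_[p]} {θ : ∀ n, MonoidAlgebra ℤ_[p] (G n)}
    (hL : ∀ n (R : ℤ_[p][X]), ((1 + PowerSeries.X : PowerSeries ℤ_[p]) ^ p ^ e n - 1) ∣ L - (R : PowerSeries ℤ_[p]) →
      (Polynomial.aeval (R := ℤ_[p]) (MonoidAlgebra.of ℤ_[p] _ (γ n) - 1)) R = θ n)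
    (hL' : ∀ n (R : ℤ_[p][X]), ((1 + PowerSeries.X : PowerSeries ℤ_[p]) ^ p ^ e n - 1) ∣ L' - (R : PowerSeries ℤ_[p]) →
      (Polynomial.aeval (R := ℤ_[p]) (MonoidAlgebra.of ℤ_[p] _ (γ n) - 1)) R = θ n) :
    L = L' := by
  haveI : IsAdicComplete (Ideal.span {(p : ℤ_[p])}) ℤ_[p] := by rw [← PadicInt.maximalIdeal_eq_span_p]; infer_instance
  refine eq_of_forall_omega_dvd_sub (S := ℤ_[p]) p fun m => ?_
  obtain ⟨n, hn⟩ := he m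
  haveI := hfin n
  exact (omega_dvd_omega p hn).trans
    (omega_dvd_sub_of_image_of_image p (γ n) (e n) (gen_pow_card p γ e hcard n) (hgen n) (hcard n) (hL n) (hL' n))

/-! ### §3 Lifts, sums and products -/

include hfin hgen hcard in
/-- **Any polynomial lift of `θ_n` is `≡ L (mod ω_{e_n})`**: if `θ_n` is the image of `L` at level `n` and `P(γ_n − 1) = θ_n`, then
`ω_{e_n} ∣ L − P` in `ℤ_p⟦X⟧` (the kernel at level `n` is `(ω_{e_n})`, part 16). [cite: Washington1997, §7.1 Thm. 7.1] -/
theorem omega_dvd_sub_coe_of_image_of_aeval_eq (n : ℕ) {L : PowerSeries ℤ_[p]} {θ : MonoidAlgebra ℤ_[p] (G n)}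
    (hL : ∀ R : ℤ_[p][X], ((1 + PowerSeries.X : PowerSeries ℤ_[p]) ^ p ^ e n - 1) ∣ L - (R : PowerSeries ℤ_[p]) →
      (Polynomial.aeval (R := ℤ_[p]) (MonoidAlgebra.of ℤ_[p] _ (γ n) - 1)) R = θ)
    {P : ℤ_[p][X]} (hP : (Polynomial.aeval (R := ℤ_[p]) (MonoidAlgebra.of ℤ_[p] _ (γ n) - 1)) P = θ) :
    ((1 + PowerSeries.X : PowerSeries ℤ_[p]) ^ p ^ e n - 1) ∣ L - (P : PowerSeries ℤ_[p]) := by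
  haveI := hfin n
  have hP' : ∀ R : ℤ_[p][X], ((1 + PowerSeries.X : PowerSeries ℤ_[p]) ^ p ^ e n - 1) ∣ (P : PowerSeries ℤ_[p]) - (R : PowerSeries ℤ_[p]) →
      (Polynomial.aeval (R := ℤ_[p]) (MonoidAlgebra.of ℤ_[p] _ (γ n) - 1)) R = θ :=
    fun R hR => (image_coe p (γ n) (e n) (gen_pow_card p γ e hcard n) P R hR).trans hP
  exact omega_dvd_sub_of_image_of_image p (γ n) (e n) (gen_pow_card p γ e hcard n) (hgen n) (hcard n) hL hP'

include hcard in
/-- The images of a sum are the sums of the images (levelwise part 16). [folklore] -/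
theorem images_add {L L' : PowerSeries ℤ_[p]} {θ θ' : ∀ n, MonoidAlgebra ℤ_[p] (G n)}
    (hL : ∀ n (R : ℤ_[p][X]), ((1 + PowerSeries.X : PowerSeries ℤ_[p]) ^ p ^ e n - 1) ∣ L - (R : PowerSeries ℤ_[p]) →
      (Polynomial.aeval (R := ℤ_[p]) (MonoidAlgebra.of ℤ_[p] _ (γ n) - 1)) R = θ n)
    (hL' : ∀ n (R : ℤ_[p][X]), ((1 + PowerSeries.X : PowerSeries ℤ_[p]) ^ p ^ e n - 1) ∣ L' - (R : PowerSeries ℤ_[p]) →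
      (Polynomial.aeval (R := ℤ_[p]) (MonoidAlgebra.of ℤ_[p] _ (γ n) - 1)) R = θ' n) :
    ∀ n (R : ℤ_[p][X]), ((1 + PowerSeries.X : PowerSeries ℤ_[p]) ^ p ^ e n - 1) ∣ (L + L') - (R : PowerSeries ℤ_[p]) →
      (Polynomial.aeval (R := ℤ_[p]) (MonoidAlgebra.of ℤ_[p] _ (γ n) - 1)) R = θ n + θ' n :=
  fun n => image_add p (γ n) (e n) (gen_pow_card p γ e hcard n) (hL n) (hL' n)

include hcard in
/-- The images of a product are the products of the images (levelwise part 16): with §2, `lim←_n ℤ_p[G_n] ≅ ℤ_p⟦X⟧` is a ring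
isomorphism. [folklore] -/
theorem images_mul {L L' : PowerSeries ℤ_[p]} {θ θ' : ∀ n, MonoidAlgebra ℤ_[p] (G n)}
    (hL : ∀ n (R : ℤ_[p][X]), ((1 + PowerSeries.X : PowerSeries ℤ_[p]) ^ p ^ e n - 1) ∣ L - (R : PowerSeries ℤ_[p]) →
      (Polynomial.aeval (R := ℤ_[p]) (MonoidAlgebra.of ℤ_[p] _ (γ n) - 1)) R = θ n)
    (hL' : ∀ n (R : ℤ_[p][X]), ((1 + PowerSeries.X : PowerSeries ℤ_[p]) ^ p ^ e n - 1) ∣ L' - (R : PowerSeries ℤ_[p]) →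
      (Polynomial.aeval (R := ℤ_[p]) (MonoidAlgebra.of ℤ_[p] _ (γ n) - 1)) R = θ' n) :
    ∀ n (R : ℤ_[p][X]), ((1 + PowerSeries.X : PowerSeries ℤ_[p]) ^ p ^ e n - 1) ∣ (L * L') - (R : PowerSeries ℤ_[p]) →
      (Polynomial.aeval (R := ℤ_[p]) (MonoidAlgebra.of ℤ_[p] _ (γ n) - 1)) R = θ n * θ' n :=
  fun n => image_mul p (γ n) (e n) (gen_pow_card p γ e hcard n) (hL n) (hL' n)

/-- The involution `ι = (σ ↦ σ⁻¹)_*` commutes with the tower maps, so `(ι θ_n)_n` is coherent when `(θ_n)_n` is (part 3 §4); in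
particular `θ_n · ι(θ_n)` is a coherent family and has its own Iwasawa power series by §2. [folklore] -/
theorem coherent_mul_mapDomain_inv (θ : ∀ n, MonoidAlgebra ℤ_[p] (G n))
    (hθ : ∀ n, MonoidAlgebra.mapDomainRingHom ℤ_[p] (π n) (θ (n + 1)) = θ n) (n : ℕ) :
    MonoidAlgebra.mapDomainRingHom ℤ_[p] (π n) (θ (n + 1) * MonoidAlgebra.mapDomain (fun σ => σ⁻¹) (θ (n + 1))) =
      θ n * MonoidAlgebra.mapDomain (fun σ => σ⁻¹) (θ n) := by
  rw [map_mul, hθ n, ← hθ n, mapDomainRingHom_mapDomain_inv p (π n) (θ (n + 1))]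

end Tower

end Summit.BirchSwinnertonDyer.BirchSwinnertonDyer.Theorems.TowerSqrt

end
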